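/-
VALUE = THEOREM, NOT summit progress (cell b2b-lgcu-borel, gen 22); crux 14079 untouched.
-/
import Mathlib
import Summits.MatrixMultiplication.MatrixMultiplication.Theorems.SubgroupIdentityDesigns.Negative.SplitFixers
import Summits.MatrixMultiplication.MatrixMultiplication.Theorems.SubgroupIdentityDesigns.Negative.DihedralUnipotent

/-!
# The signed cyclic torus `T₁ ⋊ ⟨-P⟩ ≅ T^± ⋊ A₃` lies in no member and is not factored

VALUE = THEOREM (every odd `p`, every `m ≥ 3`, every `ε`), NOT summit progress.

`T₁ = {diag(a, b, (ab)⁻¹)} ≤ GL₃(𝔽_p)` (`N`, order `(p-1)²`), `P` the permutation matrix of the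
`3`-cycle (`(Pu)_k = u_{k+1}`), `q = -P` (order `6`: `q² = P²`, `q³ = -1`, `q⁴ = P`).  The group
`K = T₁⟨q⟩ = T^± ⋊ A₃` (`T^± = {diag : det = ±1}`) has order `6(p-1)²`, is prime to `p`, lies in the
member window for every `m ≥ 3` (after `⊕ 1_{m-3}`), and at `p = 5` it is the second minimal
non-carrier class `96-B` of the generation-21 GAP scan (ORACLE-g21 §G21-24, identified in ORACLE-g22
§G22-3).  Its failing linear characters have order `6` and do not factor through `det`, so no earlier
criterion (det-cover, scalar law, `SplitFunctional`'s translated action — `-Pu ∉ T₁u` for vectors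
with exactly one zero coordinate) applies; the split-FIXER criterion `SplitFixers` does:

* `q` normalises `T₁` (`q · diag(a,b,c) · q⁻¹ = diag(b,c,a)`), `q⁶ = 1 ∈ T₁`, and `t q^i = 1`
  (`t ∈ T₁`, `i < 6`) forces `i = 0` (`i = 3` would need `t = -1`, of determinant `-1 ≠ 1`, `p` odd);
* FIXERS: a vector with a zero coordinate `u_k = 0` is fixed by the sign change `-t ∈ T₁ q³` negating
  coordinate `k` only; a vector with all coordinates non-zero is fixed by `t P ∈ T₁ q⁴` with
  `t = diag(u_0/u_1, u_1/u_2, u_2/u_0) ∈ T₁`.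

Hence (`no_design_of_cover` here; placements `no_design_mem₁/₂/₃`,
`no_design_split₁₂/₁₃/₂₃/₂₁/₃₁/₃₂` and their all-`m` versions in `SignedCyclicTorusPlacements.lean`):
**no member of a triple carrying a level-one identity design contains `T₁ ∪ {q}`, and `T₁ ⊆ H_a`,
`q ∈ H_b` is impossible for all `a, b`** — in `GL₃(𝔽_p)` and, through
`SummandTransport.design_comap`, in `GL_m(𝔽_p)` for every `m ≥ 3`.  No TPP, no character budget.

HONEST SCOPE.  Configuration exclusion; no `(p,m,ε)` cell is emptied.
-/

set_option linter.dupNamespace false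

noncomputable section

open scoped BigOperators Classical Matrix

namespace Summit.MatrixMultiplication.MatrixMultiplication.Theorems.SubgroupIdentityDesigns.Negative
namespace SignedCyclicTorus

open Summit.MatrixMultiplication.MatrixMultiplication.Theorems.LieRankDesigns.Negative (GLm Mat)
open DihedralUnipotent (neg_one_ne_one)

variable {p : ℕ} [hp : Fact p.Prime]

/-! ## Matrices -/

/-- `diag(a, b, c)`. -/
def Dmat (a b c : ZMod p) : Mat p 3 := !![a, 0, 0; 0, b, 0; 0, 0, c]

/-- The `3`-cycle permutation matrix: `(P u)_k = u_{k+1}`. -/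
def Pmat : Mat p 3 := !![0, 1, 0; 0, 0, 1; 1, 0, 0]

/-- `P²`. -/
def P2mat : Mat p 3 := !![0, 0, 1; 1, 0, 0; 0, 1, 0]

/-- Diagonal matrices multiply entrywise. -/
theorem Dmat_mul (a b c a' b' c' : ZMod p) :
    Dmat a b c * Dmat a' b' c' = Dmat (a * a') (b * b') (c * c') := by
  ext i j
  fin_cases i <;> fin_cases j <;> simp [Dmat, Matrix.mul_apply, Fin.sum_univ_three]

/-- `diag(1,1,1) = 1`. -/
theorem Dmat_one : Dmat (1 : ZMod p) 1 1 = 1 := by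
  ext i j
  fin_cases i <;> fin_cases j <;> simp [Dmat]

/-- `P · P = P²`. -/
theorem Pmat_mul_Pmat : (Pmat : Mat p 3) * Pmat = P2mat := by
  ext i j
  fin_cases i <;> fin_cases j <;> simp [Pmat, P2mat, Matrix.mul_apply, Fin.sum_univ_three]

/-- `P · P² = 1`. -/
theorem Pmat_mul_P2mat : (Pmat : Mat p 3) * P2mat = 1 := by
  ext i j
  fin_cases i <;> fin_cases j <;> simp [Pmat, P2mat, Matrix.mul_apply, Fin.sum_univ_three]

/-- `P² · P = 1`. -/
theorem P2mat_mul_Pmat : (P2mat : Mat p 3) * Pmat = 1 := by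
  ext i j
  fin_cases i <;> fin_cases j <;> simp [Pmat, P2mat, Matrix.mul_apply, Fin.sum_univ_three]

/-- `P diag(a,b,c) = diag(b,c,a) P`. -/
theorem Pmat_mul_Dmat (a b c : ZMod p) : (Pmat : Mat p 3) * Dmat a b c = Dmat b c a * Pmat := by
  ext i j
  fin_cases i <;> fin_cases j <;> simp [Dmat, Pmat, Matrix.mul_apply, Fin.sum_univ_three]

/-- `diag(a,b,c) u` in coordinates. -/
theorem Dmat_mulVec (a b c : ZMod p) (u : Fin 3 → ZMod p) :
    Dmat a b c *ᵥ u = ![a * u 0, b * u 1, c * u 2] := by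
  ext j
  fin_cases j <;> simp [Dmat, Matrix.mulVec, dotProduct, Fin.sum_univ_three]

/-- `P u` in coordinates. -/
theorem Pmat_mulVec (u : Fin 3 → ZMod p) : (Pmat : Mat p 3) *ᵥ u = ![u 1, u 2, u 0] := by
  ext j
  fin_cases j <;> simp [Pmat, Matrix.mulVec, dotProduct, Fin.sum_univ_three]

/-- Entry `(0,0)` of `diag(a,b,c)`. -/
theorem Dmat_apply₀₀ (a b c : ZMod p) : Dmat a b c 0 0 = a := by simp [Dmat]
/-- Entry `(1,1)` of `diag(a,b,c)`. -/
theorem Dmat_apply₁₁ (a b c : ZMod p) : Dmat a b c 1 1 = b := by simp [Dmat]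
/-- Entry `(2,2)` of `diag(a,b,c)`. -/
theorem Dmat_apply₂₂ (a b c : ZMod p) : Dmat a b c 2 2 = c := by simp [Dmat]

/-- `diag · P` has zero `(0,0)` entry. -/
theorem Dmat_mul_Pmat_apply₀₀ (a b c : ZMod p) : (Dmat a b c * Pmat : Mat p 3) 0 0 = 0 := by
  simp [Dmat, Pmat, Matrix.mul_apply, Fin.sum_univ_three]

/-- `diag · P²` has zero `(0,0)` entry. -/
theorem Dmat_mul_P2mat_apply₀₀ (a b c : ZMod p) : (Dmat a b c * P2mat : Mat p 3) 0 0 = 0 := by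
  simp [Dmat, P2mat, Matrix.mul_apply, Fin.sum_univ_three]

/-- `(diag(a,b,c) P) u = (a u_1, b u_2, c u_0)`. -/
theorem Dmat_Pmat_mulVec (a b c : ZMod p) (u : Fin 3 → ZMod p) :
    (Dmat a b c * Pmat : Mat p 3) *ᵥ u = ![a * u 1, b * u 2, c * u 0] := by
  rw [← Matrix.mulVec_mulVec, Pmat_mulVec, Dmat_mulVec]
  ext j
  fin_cases j <;> simp

/-- Negation of a `3`-vector literal. -/
theorem neg_vec₃ (x y z : ZMod p) : -![x, y, z] = ![-x, -y, -z] := by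
  ext j
  fin_cases j <;> simp

/-! ## The torus `T₁` and the element `q = -P` -/

/-- `diag(a, b, (ab)⁻¹) ∈ GL₃(𝔽_p)`. -/
def torGL (a b : (ZMod p)ˣ) : GLm p 3 :=
  ⟨Dmat a b ((a * b)⁻¹ : (ZMod p)ˣ), Dmat (a⁻¹ : (ZMod p)ˣ) (b⁻¹ : (ZMod p)ˣ) (a * b : (ZMod p)ˣ),
    by rw [Dmat_mul, Units.mul_inv, Units.mul_inv, Units.inv_mul, Dmat_one],
    by rw [Dmat_mul, Units.inv_mul, Units.inv_mul, Units.mul_inv, Dmat_one]⟩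

/-- The matrix of `torGL a b`. -/
theorem coe_torGL (a b : (ZMod p)ˣ) :
    ((torGL a b : GLm p 3) : Mat p 3) = Dmat a b ((a * b)⁻¹ : (ZMod p)ˣ) := rfl

/-- The torus `T₁` as the range of `(a, b) ↦ diag(a, b, (ab)⁻¹)`. -/
def tor : (ZMod p)ˣ × (ZMod p)ˣ →* GLm p 3 where
  toFun x := torGL x.1 x.2
  map_one' := Units.ext (by simp [coe_torGL, Dmat_one])
  map_mul' x y := Units.ext (by
    simp only [Prod.fst_mul, Prod.snd_mul, Units.val_mul, coe_torGL]
    rw [Dmat_mul, mul_mul_mul_comm x.1 y.1, mul_inv, Units.val_mul])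

/-- Unfolding `tor`. -/
theorem tor_apply (a b : (ZMod p)ˣ) : tor (a, b) = torGL a b := rfl

/-- The matrix of `tor (a, b)`. -/
theorem coe_tor (a b : (ZMod p)ˣ) :
    ((tor (a, b) : GLm p 3) : Mat p 3) = Dmat a b ((a * b)⁻¹ : (ZMod p)ˣ) := rfl

/-- `T₁ = {diag(a, b, (ab)⁻¹)}`. -/
def N : Subgroup (GLm p 3) := (tor (p := p)).range

/-- `diag(a,b,(ab)⁻¹) ∈ T₁`. -/
theorem tor_mem (a b : (ZMod p)ˣ) : tor (a, b) ∈ (N : Subgroup (GLm p 3)) := ⟨(a, b), rfl⟩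

/-- `P ∈ GL₃(𝔽_p)`. -/
def PGL : GLm p 3 := ⟨Pmat, P2mat, Pmat_mul_P2mat, P2mat_mul_Pmat⟩

/-- `P² ∈ GL₃(𝔽_p)`. -/
def P2GL : GLm p 3 := ⟨P2mat, Pmat, P2mat_mul_Pmat, Pmat_mul_P2mat⟩

/-- `q = -P`, of order `6`. -/
def q : GLm p 3 := -PGL

/-- The matrix of `P`. -/
theorem coe_PGL : ((PGL : GLm p 3) : Mat p 3) = Pmat := rfl
/-- The matrix of `P²`. -/
theorem coe_P2GL : ((P2GL : GLm p 3) : Mat p 3) = P2mat := rfl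
/-- The matrix of `q = -P`. -/
theorem coe_q : ((q : GLm p 3) : Mat p 3) = -Pmat := rfl

/-- `q² = P²`. -/
theorem q_sq : (q : GLm p 3) ^ 2 = P2GL :=
  Units.ext (by rw [pow_two, Units.val_mul, coe_q, neg_mul_neg, Pmat_mul_Pmat]; rfl)

/-- `q³ = -1`. -/
theorem q_cube : (q : GLm p 3) ^ 3 = -1 := by
  rw [pow_succ, q_sq]
  exact Units.ext (by
    rw [Units.val_mul, coe_P2GL, coe_q, mul_neg, P2mat_mul_Pmat, Units.val_neg, Units.val_one])

/-- `q⁴ = P`. -/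
theorem q_pow_four : (q : GLm p 3) ^ 4 = PGL := by
  rw [pow_succ, q_cube, q, neg_mul_neg, one_mul]

/-- `q⁵ = -P²`. -/
theorem q_pow_five : (q : GLm p 3) ^ 5 = -P2GL := by
  rw [pow_succ, q_pow_four, q, mul_neg]
  congr 1
  exact Units.ext (by rw [Units.val_mul, coe_PGL, Pmat_mul_Pmat]; rfl)

/-- `q⁶ = 1`. -/
theorem q_pow_six : (q : GLm p 3) ^ 6 = 1 := by
  rw [show 6 = 3 * 2 by norm_num, pow_mul, q_cube, neg_one_sq]

/-! ## The hypotheses of `SplitFixers` -/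

/-- `q · diag(a,b,(ab)⁻¹) = diag(b,(ab)⁻¹,a) · q`. -/
theorem q_mul_tor (a b : (ZMod p)ˣ) : q * tor (a, b) = tor (b, (a * b)⁻¹) * q := by
  have key : ((b * (a * b)⁻¹)⁻¹ : (ZMod p)ˣ) = a := by
    rw [mul_inv_rev, inv_inv, mul_inv_cancel_right]
  apply Units.ext
  rw [Units.val_mul, Units.val_mul, coe_q, coe_tor, coe_tor, key, neg_mul, mul_neg, Pmat_mul_Dmat]

/-- `diag(a,b,(ab)⁻¹) · q = q · diag((ab)⁻¹, a, b)`. -/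
theorem tor_mul_q (a b : (ZMod p)ˣ) : tor (a, b) * q = q * tor ((a * b)⁻¹, a) := by
  have key : (((a * b)⁻¹ * a)⁻¹ : (ZMod p)ˣ) = b := by
    rw [mul_inv_rev, inv_inv, inv_mul_cancel_left]
  apply Units.ext
  rw [Units.val_mul, Units.val_mul, coe_q, coe_tor, coe_tor, key, neg_mul, mul_neg, Pmat_mul_Dmat]

/-- `q` normalises `T₁`. -/
theorem q_mem_normalizer : (q : GLm p 3) ∈ Subgroup.normalizer ((N : Subgroup (GLm p 3)) : Set (GLm p 3)) := by
  refine SplitFixers.mem_normalizer_of_conj (fun n hn => ?_) (fun n hn => ?_)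
  · obtain ⟨⟨a, b⟩, rfl⟩ := hn
    rw [q_mul_tor, mul_inv_cancel_right]
    exact tor_mem _ _
  · obtain ⟨⟨a, b⟩, rfl⟩ := hn
    rw [mul_assoc, tor_mul_q, ← mul_assoc, inv_mul_cancel, one_mul]
    exact tor_mem _ _

/-- `q⁶ ∈ T₁`. -/
theorem q_pow_six_mem : (q : GLm p 3) ^ 6 ∈ (N : Subgroup (GLm p 3)) := by
  rw [q_pow_six]; exact N.one_mem

/-- `6` is the exact order of `q` modulo `T₁` (`p` odd). -/
theorem hone (hp2 : p ≠ 2) :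
    ∀ n ∈ (N : Subgroup (GLm p 3)), ∀ i < 6, (n : GLm p 3) * q ^ i = 1 → i = 0 := by
  intro n hn i hi heq
  obtain ⟨⟨a, b⟩, rfl⟩ := hn
  have hM := congrArg (fun g : GLm p 3 => (g : Mat p 3)) heq
  simp only [Units.val_mul, Units.val_one] at hM
  interval_cases i
  · rfl
  · exfalso
    rw [pow_one, coe_tor, coe_q, mul_neg] at hM
    have h := congrFun (congrFun hM 0) 0
    rw [Matrix.neg_apply, Dmat_mul_Pmat_apply₀₀, Matrix.one_apply_eq, neg_zero] at h
    exact zero_ne_one h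
  · exfalso
    rw [q_sq, coe_tor, coe_P2GL] at hM
    have h := congrFun (congrFun hM 0) 0
    rw [Dmat_mul_P2mat_apply₀₀, Matrix.one_apply_eq] at h
    exact zero_ne_one h
  · exfalso
    rw [q_cube, coe_tor, Units.val_neg, Units.val_one, mul_neg, mul_one] at hM
    have h0 := congrFun (congrFun hM 0) 0
    have h1 := congrFun (congrFun hM 1) 1
    have h2 := congrFun (congrFun hM 2) 2
    rw [Matrix.neg_apply, Dmat_apply₀₀, Matrix.one_apply_eq] at h0
    rw [Matrix.neg_apply, Dmat_apply₁₁, Matrix.one_apply_eq] at h1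
    rw [Matrix.neg_apply, Dmat_apply₂₂, Matrix.one_apply_eq] at h2
    have ha : (a : ZMod p) = -1 := by linear_combination -h0
    have hb : (b : ZMod p) = -1 := by linear_combination -h1
    rw [Units.val_inv_eq_inv_val, Units.val_mul, ha, hb, neg_mul_neg, one_mul, inv_one] at h2
    exact neg_one_ne_one hp2 h2
  · exfalso
    rw [q_pow_four, coe_tor, coe_PGL] at hM
    have h := congrFun (congrFun hM 0) 0
    rw [Dmat_mul_Pmat_apply₀₀, Matrix.one_apply_eq] at h
    exact zero_ne_one h
  · exfalso
    rw [q_pow_five, coe_tor, Units.val_neg, coe_P2GL, mul_neg] at hM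
    have h := congrFun (congrFun hM 0) 0
    rw [Matrix.neg_apply, Dmat_mul_P2mat_apply₀₀, Matrix.one_apply_eq, neg_zero] at h
    exact zero_ne_one h

/-- **FIXERS**: every vector is fixed by some `t q^i`, `t ∈ T₁`, `0 < i < 6`. -/
theorem hfix : ∀ u : Fin 3 → ZMod p, ∃ n ∈ (N : Subgroup (GLm p 3)), ∃ i < 6, i ≠ 0 ∧
    ((((n : GLm p 3) * q ^ i : GLm p 3) : Mat p 3) *ᵥ u = u) := by
  intro u
  -- sign changes `-t ∈ T₁ q³`
  have sign : ∀ a b : (ZMod p)ˣ,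
      (((tor (a, b) * q ^ 3 : GLm p 3) : Mat p 3) *ᵥ u) =
        ![-((a : ZMod p) * u 0), -((b : ZMod p) * u 1), -((((a * b)⁻¹ : (ZMod p)ˣ) : ZMod p) * u 2)] := by
    intro a b
    rw [q_cube, Units.val_mul, coe_tor, Units.val_neg, Units.val_one, mul_neg, mul_one,
      Matrix.neg_mulVec, Dmat_mulVec, neg_vec₃]
  have inv_neg_one : (-1 : (ZMod p)ˣ)⁻¹ = -1 :=
    inv_eq_of_mul_eq_one_right (by rw [neg_mul_neg, one_mul])
  by_cases h2 : u 2 = 0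
  · refine ⟨tor (-1, -1), tor_mem _ _, 3, by norm_num, by norm_num, ?_⟩
    have e : ((-1 : (ZMod p)ˣ) * -1)⁻¹ = 1 := by rw [neg_mul_neg, one_mul, inv_one]
    rw [sign, e, Units.val_neg, Units.val_one]
    ext j; fin_cases j
    · simp
    · simp
    · simp [h2]
  by_cases h1 : u 1 = 0
  · refine ⟨tor (-1, 1), tor_mem _ _, 3, by norm_num, by norm_num, ?_⟩
    have e : ((-1 : (ZMod p)ˣ) * 1)⁻¹ = -1 := by rw [mul_one, inv_neg_one]
    rw [sign, e, Units.val_neg, Units.val_one]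
    ext j; fin_cases j
    · simp
    · simp [h1]
    · simp
  by_cases h0 : u 0 = 0
  · refine ⟨tor (1, -1), tor_mem _ _, 3, by norm_num, by norm_num, ?_⟩
    have e : ((1 : (ZMod p)ˣ) * -1)⁻¹ = -1 := by rw [one_mul, inv_neg_one]
    rw [sign, e, Units.val_neg, Units.val_one]
    ext j; fin_cases j
    · simp [h0]
    · simp
    · simp
  -- all coordinates non-zero: `t P ∈ T₁ q⁴`
  refine ⟨tor (Units.mk0 (u 0 / u 1) (div_ne_zero h0 h1), Units.mk0 (u 1 / u 2) (div_ne_zero h1 h2)),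
    tor_mem _ _, 4, by norm_num, by norm_num, ?_⟩
  rw [q_pow_four, Units.val_mul, coe_tor, coe_PGL, Dmat_Pmat_mulVec]
  simp only [Units.val_inv_eq_inv_val, Units.val_mul, Units.val_mk0]
  have e0 : u 0 / u 1 * u 1 = u 0 := div_mul_cancel₀ _ h1
  have e1 : u 1 / u 2 * u 2 = u 1 := div_mul_cancel₀ _ h2
  have e2 : (u 0 / u 1 * (u 1 / u 2))⁻¹ * u 0 = u 2 := by
    rw [div_mul_div_comm, mul_comm (u 0) (u 1), ← div_mul_div_comm, div_self h1, one_mul, inv_div,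
      div_mul_cancel₀ _ h0]
  rw [e0, e1, e2]
  ext j; fin_cases j <;> rfl

/-! ## The exclusions in `GL₃(𝔽_p)` -/

section GL3

variable {H₁ H₂ H₃ : Subgroup (GLm p 3)}

/-- Shared core: any cover of `T₁ q^i ∖ 1` by triple products excludes a level-one design. -/
theorem no_design_of_cover (hp2 : p ≠ 2)
    (hcov : ∀ n ∈ (N : Subgroup (GLm p 3)), ∀ i < 6, (n : GLm p 3) * q ^ i ≠ 1 →
      ∃ a ∈ H₁, ∃ b ∈ H₂, ∃ c ∈ H₃, a * b * c = n * q ^ i) :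
    ¬ ∃ c : Mat p 3 → ℂ, (∀ M, 1 < M.rank → c M = 0) ∧
      (∑ M, c M * ZMod.stdAddChar (Matrix.trace (M * ((1 : GLm p 3) : Mat p 3)))) = 1 ∧
      ∀ a ∈ H₁, ∀ b ∈ H₂, ∀ g ∈ H₃, a * b * g ≠ 1 →
        (∑ M, c M * ZMod.stdAddChar (Matrix.trace (M * ((a * b * g : GLm p 3) : Mat p 3)))) = 0 :=
  SplitFixers.no_design_of_splitFixers N q (by norm_num) q_mem_normalizer q_pow_six_mem (hone hp2)
    hfix hcov

/-- `T₁ ≤ H` from membership of the generators `diag(a,b,(ab)⁻¹)`. -/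
theorem N_le_of {H : Subgroup (GLm p 3)} (hT : ∀ a b : (ZMod p)ˣ, tor (a, b) ∈ H) :
    (N : Subgroup (GLm p 3)) ≤ H := by
  rintro _ ⟨⟨a, b⟩, rfl⟩; exact hT a b

end GL3

end SignedCyclicTorus
end Summit.MatrixMultiplication.MatrixMultiplication.Theorems.SubgroupIdentityDesigns.Negative
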